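import Summits.PneNP.PneNP.Theorems.ChebyshevTracialDesignJuntaVirtualMoment
import Summits.PneNP.PneNP.Theorems.ChebyshevTracialDesignJuntaMatchingLaw
import HarnessLib

/-!
# Junta virtual positivity, part H: the virtual quadratic form is Grigoriev's knapsack form

Support file for the crux `TracialDecayExp20` (stmt-PneNP-19878) of route `ChebyshevTracialDesign`
(cell pnp-psdrank, low-degree sector of the virtual-positivity step, p1 ROUND-3 §2.14: "the virtual level is
Grigoriev's knapsack functional"). For a perfect matching `M` of `K_n` with `N = n/2` edges:

* `virtualForm_eq_knapsackForm` / `virtualForm_nonneg`: for coefficients `γ` on vertex sets `A'` with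
  `|A'| ≤ k`, the quadratic form `Σ_{A',A''} γ(A') γ(A'') · knapsackMoment N r |M[A' ∪ A'']|` is Grigoriev's
  `knapsackForm N r h` for the push-forward `h` of `γ` along `A' ↦ M[A']` (edge sets indexed by `Fin N`),
  hence `≥ 0` under `Literature.Computability.Complexity.Grigoriev2001_knapsackFormNonneg` in the range
  `2k ≤ N`, `k - 1 < r < N - k + 1` (named fact = Grigoriev 2001 Lemma 1.4, used as a HYPOTHESIS);
* `containment_comb_poly`: linear combinations of containment events `Σ_s β_s 1[D_s ⊆ U]` have level sums
  `T(N; c, i)·P(c)` with `deg P ≤ d` (`|M[D_s]| ≤ d`) and `P(0) = Σ_s β_s · knapsackMoment N (t/2) |M[D_s]|`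
  (part G).

No definitions.
-/

set_option linter.dupNamespace false -- `Summit.PneNP.PneNP.…`: summit = sub-problem (D-0017)

namespace Summit.PneNP.PneNP.Theorems.ChebyshevTracialDesignJunta

open Finset Literature.Barriers.PneNP Literature.Combinatorics.SimpleGraph.CycleSpace
open Polynomial Literature.Computability.Complexity

variable {n : ℕ}

/-! ### Transport of edge sets of `M` to `Fin N` -/

/-- The index set in `Fin |M|` of a sub-edge-set `E ⊆ M` has `|E|` elements. [folklore] -/
theorem card_filter_equivFin_symm_mem (M : Finset (Sym2 (Fin n))) {E : Finset (Sym2 (Fin n))} (hE : E ⊆ M) :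
    ((univ : Finset (Fin M.card)).filter fun x => ((M.equivFin.symm x) : Sym2 (Fin n)) ∈ E).card = E.card := by
  refine card_bij' (fun x _ => ((M.equivFin.symm x) : Sym2 (Fin n))) (fun e he => M.equivFin ⟨e, hE he⟩)
    ?_ ?_ ?_ ?_
  · intro x hx; exact (mem_filter.1 hx).2
  · intro e he
    refine mem_filter.2 ⟨mem_univ _, ?_⟩
    simp [he]
  · intro x _; simp
  · intro e _; simp

/-- Index sets of unions are unions of index sets. [folklore] -/
theorem filter_equivFin_symm_mem_union (M : Finset (Sym2 (Fin n))) (E E' : Finset (Sym2 (Fin n))) :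
    ((univ : Finset (Fin M.card)).filter fun x => ((M.equivFin.symm x) : Sym2 (Fin n)) ∈ E ∪ E') =
      ((univ : Finset (Fin M.card)).filter fun x => ((M.equivFin.symm x) : Sym2 (Fin n)) ∈ E) ∪
        (univ : Finset (Fin M.card)).filter fun x => ((M.equivFin.symm x) : Sym2 (Fin n)) ∈ E' := by
  ext x; simp [mem_filter, mem_union]

/-- Window edge sets of unions are unions of window edge sets. [folklore] -/
theorem filter_meets_union (M : Finset (Sym2 (Fin n))) (A A' : Finset (Fin n)) :
    (M.filter fun e => ∃ a ∈ A ∪ A', a ∈ e) =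
      (M.filter fun e => ∃ a ∈ A, a ∈ e) ∪ M.filter fun e => ∃ a ∈ A', a ∈ e := by
  ext e
  simp only [mem_filter, mem_union]
  constructor
  · rintro ⟨he, a, ha, hae⟩
    rcases ha with ha | ha
    · exact Or.inl ⟨he, a, ha, hae⟩
    · exact Or.inr ⟨he, a, ha, hae⟩
  · rintro (⟨he, a, ha, hae⟩ | ⟨he, a, ha, hae⟩)
    · exact ⟨he, a, Or.inl ha, hae⟩
    · exact ⟨he, a, Or.inr ha, hae⟩

/-! ### The virtual quadratic form as a knapsack form -/

/-- **The virtual quadratic form is a knapsack form**: `Σ_{A',A''} γ(A')γ(A'')·B_{|M[A'∪A'']|} =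
knapsackForm N r h` with `h(I) = Σ_{A' : M[A'] ↦ I} γ(A')`. [cite: Grigoriev2001, §1 (PDF p. 8)] -/
theorem virtualForm_eq_knapsackForm (M : PMatch n) (r : ℝ) {k : ℕ}
    (γ : {A' : Finset (Fin n) // A'.card ≤ k} → ℝ) :
    ∑ A' : {A' : Finset (Fin n) // A'.card ≤ k}, ∑ A'' : {A' : Finset (Fin n) // A'.card ≤ k},
        γ A' * γ A'' * knapsackMoment M.1.card r (M.1.filter fun e => ∃ a ∈ A'.1 ∪ A''.1, a ∈ e).card =
      knapsackForm M.1.card r (fun I => ∑ A' ∈ (univ : Finset {A' : Finset (Fin n) // A'.card ≤ k}).filter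
          (fun A' => ((univ : Finset (Fin M.1.card)).filter fun x =>
            ((M.1.equivFin.symm x) : Sym2 (Fin n)) ∈ M.1.filter fun e => ∃ a ∈ A'.1, a ∈ e) = I), γ A') := by
  classical
  -- abbreviation: the index set of the window edges of `A'`
  set φ : {A' : Finset (Fin n) // A'.card ≤ k} → Finset (Fin M.1.card) := fun A' =>
    (univ : Finset (Fin M.1.card)).filter fun x =>
      ((M.1.equivFin.symm x) : Sym2 (Fin n)) ∈ M.1.filter fun e => ∃ a ∈ A'.1, a ∈ e with hφ
  have hcard : ∀ A' A'' : {A' : Finset (Fin n) // A'.card ≤ k},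
      (φ A' ∪ φ A'').card = (M.1.filter fun e => ∃ a ∈ A'.1 ∪ A''.1, a ∈ e).card := by
    intro A' A''
    rw [hφ]
    dsimp only
    rw [← filter_equivFin_symm_mem_union, ← filter_meets_union,
      card_filter_equivFin_symm_mem M.1 (filter_subset _ _)]
  unfold knapsackForm
  -- regroup the double sum over `(A', A'')` by the fibres of `φ`
  symm
  calc ∑ I : Finset (Fin M.1.card), ∑ J : Finset (Fin M.1.card),
        (∑ A' ∈ univ.filter (fun A' => φ A' = I), γ A') * (∑ A'' ∈ univ.filter (fun A' => φ A' = J), γ A'') *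
          knapsackMoment M.1.card r (I ∪ J).card
      = ∑ I : Finset (Fin M.1.card), ∑ J : Finset (Fin M.1.card),
          ∑ A' ∈ univ.filter (fun A' => φ A' = I), ∑ A'' ∈ univ.filter (fun A' => φ A' = J),
            γ A' * γ A'' * knapsackMoment M.1.card r (φ A' ∪ φ A'').card := by
        refine sum_congr rfl fun I _ => sum_congr rfl fun J _ => ?_
        rw [sum_mul, sum_mul]
        refine sum_congr rfl fun A' hA' => ?_
        rw [mul_sum, sum_mul]
        refine sum_congr rfl fun A'' hA'' => ?_
        rw [(mem_filter.1 hA').2, (mem_filter.1 hA'').2]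
    _ = ∑ I : Finset (Fin M.1.card), ∑ A' ∈ univ.filter (fun A' => φ A' = I),
          ∑ J : Finset (Fin M.1.card), ∑ A'' ∈ univ.filter (fun A' => φ A' = J),
            γ A' * γ A'' * knapsackMoment M.1.card r (φ A' ∪ φ A'').card :=
        sum_congr rfl fun I _ => sum_comm
    _ = ∑ A' : {A' : Finset (Fin n) // A'.card ≤ k}, ∑ J : Finset (Fin M.1.card),
          ∑ A'' ∈ univ.filter (fun A' => φ A' = J),
            γ A' * γ A'' * knapsackMoment M.1.card r (φ A' ∪ φ A'').card := by
        rw [sum_fiberwise_of_maps_to (fun A' _ => mem_univ (φ A'))]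
    _ = ∑ A' : {A' : Finset (Fin n) // A'.card ≤ k}, ∑ A'' : {A' : Finset (Fin n) // A'.card ≤ k},
          γ A' * γ A'' * knapsackMoment M.1.card r (φ A' ∪ φ A'').card := by
        refine sum_congr rfl fun A' _ => ?_
        rw [sum_fiberwise_of_maps_to (fun A'' _ => mem_univ (φ A''))]
    _ = ∑ A' : {A' : Finset (Fin n) // A'.card ≤ k}, ∑ A'' : {A' : Finset (Fin n) // A'.card ≤ k},
          γ A' * γ A'' * knapsackMoment M.1.card r (M.1.filter fun e => ∃ a ∈ A'.1 ∪ A''.1, a ∈ e).card := by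
        refine sum_congr rfl fun A' _ => sum_congr rfl fun A'' _ => ?_
        rw [hcard]

/-- **The virtual quadratic form is nonnegative under Grigoriev's Lemma 1.4** (the named fact
`Grigoriev2001_knapsackFormNonneg` as a hypothesis): for `2k ≤ N`, `k - 1 < r < N - k + 1` and coefficients
`γ` on vertex sets of size `≤ k`, `0 ≤ Σ_{A',A''} γ(A')γ(A'')·B_{|M[A'∪A'']|}`.
[cite: Grigoriev2001, Lemma 1.4 (PDF p. 8)] -/
theorem virtualForm_nonneg (hG : Grigoriev2001_knapsackFormNonneg) (M : PMatch n) {r : ℝ} {k : ℕ}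
    (hk : 2 * k ≤ M.1.card) (hr₁ : (k : ℝ) - 1 < r) (hr₂ : r < (M.1.card : ℝ) - k + 1)
    (γ : {A' : Finset (Fin n) // A'.card ≤ k} → ℝ) :
    0 ≤ ∑ A' : {A' : Finset (Fin n) // A'.card ≤ k}, ∑ A'' : {A' : Finset (Fin n) // A'.card ≤ k},
        γ A' * γ A'' * knapsackMoment M.1.card r (M.1.filter fun e => ∃ a ∈ A'.1 ∪ A''.1, a ∈ e).card := by
  rw [virtualForm_eq_knapsackForm]
  refine hG M.1.card k r hk hr₁ hr₂ _ fun I hI => ?_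
  -- coefficients vanish on `|I| > k`: every contributing `A'` has `|M[A']| ≤ |A'| ≤ k`
  refine sum_eq_zero fun A' hA' => ?_
  exfalso
  have hAI := (mem_filter.1 hA').2
  have h1 : I.card = (M.1.filter fun e => ∃ a ∈ A'.1, a ∈ e).card := by
    rw [← hAI, card_filter_equivFin_symm_mem M.1 (filter_subset _ _)]
  -- (the general lemma's `DecidablePred` instance is normalised to the ambient one)
  have h2 : (M.1.filter fun e => ∃ a ∈ A'.1, a ∈ e).card ≤ A'.1.card := by
    convert card_filter_meets_le M.2 A'.1 using 3
  have h3 : A'.1.card ≤ k := A'.2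
  omega

/-! ### Linear combinations of containment events -/

/-- **Level sums of linear combinations of containment events** (part G summed): for a perfect matching
`M` of `K_n`, finitely many events `D_s ⊆ U` with `|M[D_s]| ≤ d` and coefficients `β_s`, there is a real
polynomial `P` of degree `≤ d` with `P(0) = Σ_s β_s · knapsackMoment N (t/2) |M[D_s]|` and
`Σ_{U : c crossing, i internal} Σ_s β_s 1[D_s ⊆ U] = T(N; c, i)·P(c)` for `c + 2i = t`. [folklore] -/
theorem containment_comb_poly (M : PMatch n) (t d : ℕ) {σ : Type*} [Fintype σ] (β : σ → ℝ)
    (Dset : σ → Finset (Fin n)) (hD : ∀ s, (M.1.filter fun e => ∃ a ∈ Dset s, a ∈ e).card ≤ d) :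
    ∃ P : Polynomial ℝ, P.natDegree ≤ d ∧
      P.eval 0 = ∑ s, β s * knapsackMoment M.1.card ((t : ℝ) / 2) (M.1.filter fun e => ∃ a ∈ Dset s, a ∈ e).card ∧
      ∀ c i : ℕ, c + 2 * i = t →
        ∑ U ∈ (univ : Finset (Fin n)).powerset.filter (fun U =>
            (M.1.filter fun e => cutCount U e = 1).card = c ∧ (M.1.filter fun e => cutCount U e = 2).card = i),
          (∑ s, β s * (if Dset s ⊆ U then (1 : ℝ) else 0)) =
          ((M.1.card.choose (c + i) * (c + i).choose i * 2 ^ c : ℕ) : ℝ) * P.eval (c : ℝ) := by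
  have hP : ∀ s : σ, ∃ P : Polynomial ℝ, P.natDegree ≤ (M.1.filter fun e => ∃ a ∈ Dset s, a ∈ e).card ∧
      P.eval 0 = knapsackMoment M.1.card ((t : ℝ) / 2) (M.1.filter fun e => ∃ a ∈ Dset s, a ∈ e).card ∧
      ∀ c i : ℕ, c + 2 * i = t →
        ((((univ : Finset (Fin n)).powerset.filter fun U => (M.1.filter fun e => cutCount U e = 1).card = c ∧
            (M.1.filter fun e => cutCount U e = 2).card = i ∧ Dset s ⊆ U).card : ℕ) : ℝ) =
          ((M.1.card.choose (c + i) * (c + i).choose i * 2 ^ c : ℕ) : ℝ) * P.eval (c : ℝ) := by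
    intro s
    -- (the general lemma's `DecidablePred` instances are converted to the ambient ones)
    obtain ⟨P, h1, h2, h3⟩ := subset_event_poly M.2 (subset_univ (Dset s)) t
    exact ⟨P, by convert h1 using 3, by convert h2 using 4, fun c i hci => by convert h3 c i hci using 5⟩
  choose P hPdeg hP0 hPval using hP
  refine ⟨∑ s, C (β s) * P s, ?_, ?_, ?_⟩
  · exact natDegree_sum_le_of_forall_le _ _ fun s _ => (natDegree_C_mul_le _ _).trans ((hPdeg s).trans (hD s))
  · rw [eval_finsetSum]
    exact sum_congr rfl fun s _ => by rw [eval_mul, eval_C, hP0 s]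
  · intro c i hci
    rw [sum_comm, eval_finsetSum, mul_sum]
    refine sum_congr rfl fun s _ => ?_
    rw [← mul_sum, ← sum_filter, sum_const, nsmul_eq_mul, mul_one, filter_filter, eval_mul, eval_C]
    have hset : ((univ : Finset (Fin n)).powerset.filter fun U =>
          ((M.1.filter fun e => cutCount U e = 1).card = c ∧ (M.1.filter fun e => cutCount U e = 2).card = i) ∧
            Dset s ⊆ U) =
        (univ : Finset (Fin n)).powerset.filter fun U => (M.1.filter fun e => cutCount U e = 1).card = c ∧
          (M.1.filter fun e => cutCount U e = 2).card = i ∧ Dset s ⊆ U :=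
      filter_congr fun U _ => and_assoc
    rw [hset, hPval s c i hci]
    ring

end Summit.PneNP.PneNP.Theorems.ChebyshevTracialDesignJunta
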